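import Literature.Analysis.OperatorTheory.BirmanSchwingerCount
import HarnessLib

/-!
# Birman–Schwinger comparison count WITHOUT `σ > sup V` (clipped nonnegative majorants)

Topic `Literature/Analysis/OperatorTheory`; sibling of `BirmanSchwingerCount.lean` (same setting and
notation: Schrödinger-type form `a ≥ a₀ + v`, mass `ms`, Birman–Schwinger pencil `(a₀, σ·ms − v)`, Liu's
projection data on a comparison pair `a' ≤ a₀`, `σ·ms − v ≤ b'`; Frank–Laptev–Weidl 2022 Thm 1.52 / 1.25,
Liu 2015 Thm 2.1).

The companion file assumes `v ≤ V_max·ms` with `V_max < σ`, i.e. the potential stays below the level on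
the whole domain. On domains reaching small `R` (the Grad–Shafranov operator `−Δ* ↦ −Δ + 3/(4R²)` on a
low-aspect-ratio cross-section: `sup V = 3/(4R_min²)` exceeds `λ₁`) that fails, yet nothing in the
argument needs it: on the eigen-span of `a` the Birman–Schwinger mass is positive as soon as `a₀ ⪰ 0` and
the levels are `< σ` — for `φ = Σ c_i u_i`, `σ·ms(φ,φ) − v(φ,φ) ≥ Σ(σ − λ_i)c_i² + a₀(φ,φ) ≥ (1 − Λ)σ·Σc_i²`
(`schrodinger_span_mass_lower_of_nonneg`; Frank–Laptev–Weidl's (H_α) asks positivity (1.63) of the form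
on the test space only, and Thm 1.52 carries no sign condition on `b` relative to the level). The
comparison form `b'` is then an elementwise CLIPPED NONNEGATIVE majorant of `σ − V` (so `b' ⪰ 0` for Liu's
one-vector inequality), which is the client's business. Results: `liu_schrodinger_count_bound_of_nonneg`
(`Λ`-form, strict `Λ < 1`), `exists_schrodinger_level_ge_of_nonneg`, `card_schrodinger_lt_le_of_nonneg`
(at most `m` levels below `lo·σ`). WHAT THIS IS NOT: as the companion — only the `≤` direction of the
Birman–Schwinger principle, operator-free, no essential spectrum; the clipping rule itself (a finite-element
device) is not formalised here. Everything PROVED (standard axioms); no named facts.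
[cite: FrankLaptevWeidl2022, Thm 1.52 (§1.2.8) with Thm 1.25 (§1.2.3)] [cite: Liu2015, Thm 2.1]
-/

namespace Literature.Analysis.OperatorTheory

open scoped BigOperators
open Finset

variable {V : Type*} [AddCommGroup V] [Module ℝ V]

/-- **Positivity of the Birman–Schwinger mass on the eigen-span from `a₀ ⪰ 0`.** If `u` is `ms`-orthonormal
and `a`-diagonal with levels `λ_i ≤ Λσ`, and `a₀ + v ≤ a` with `a₀ ⪰ 0`, then
`(1 − Λ)σ·Σ c_i² ≤ σ·ms(φ,φ) − v(φ,φ)` for `φ = Σ c_i u_i` — no bound on `sup V` is used.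
[cite: FrankLaptevWeidl2022, §1.2.8 assumption (H_α) (1.63) (positivity on the test space only)] -/
theorem schrodinger_span_mass_lower_of_nonneg (a a₀ ms v : LinearMap.BilinForm ℝ V)
    (ha₀_nonneg : ∀ x, 0 ≤ a₀ x x) (ha₀_le : ∀ x, a₀ x x + v x x ≤ a x x)
    {k : ℕ} (u : Fin k → V) (lam : Fin k → ℝ) {Λ σ : ℝ}
    (hms_on : ∀ i j, ms (u i) (u j) = if i = j then 1 else 0)
    (ha_on : ∀ i j, a (u i) (u j) = if i = j then lam i else 0)
    (hlam : ∀ i, lam i ≤ Λ * σ) (c : Fin k → ℝ) :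
    (1 - Λ) * σ * ∑ i, c i ^ 2 ≤
      σ * ms (∑ i, c i • u i) (∑ i, c i • u i) - v (∑ i, c i • u i) (∑ i, c i • u i) := by
  classical
  set φ : V := ∑ i, c i • u i with hφdef
  have hmsφ : ms φ φ = ∑ i, c i ^ 2 := by
    rw [hφdef, bilin_sum_sum_of_kronecker ms u (fun _ => (1 : ℝ)) (by simpa using hms_on) c]
    simp
  have haφ : a φ φ = ∑ i, lam i * c i ^ 2 := by
    rw [hφdef, bilin_sum_sum_of_kronecker a u lam ha_on c]
  have haΛ : a φ φ ≤ Λ * σ * ms φ φ := by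
    rw [haφ, hmsφ, Finset.mul_sum]
    exact Finset.sum_le_sum fun i _ => mul_le_mul_of_nonneg_right (hlam i) (sq_nonneg _)
  have h0 := ha₀_nonneg φ
  have h1 := ha₀_le φ
  rw [hmsφ] at haΛ ⊢
  nlinarith

/-- **Liu's counting bound through the Birman–Schwinger pencil, `Λ`-form WITHOUT `σ > sup V`.** As
`liu_schrodinger_count_bound`, with the hypotheses `v ≤ V_max·ms`, `V_max < σ` replaced by `a₀ ⪰ 0`,
`0 < σ` and the STRICT level bound `Λ < 1` (positivity of `σ·ms − v` on the eigen-span then comes from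
`schrodinger_span_mass_lower_of_nonneg`). Use: Schrödinger-type operators on domains where the potential
exceeds the level somewhere (e.g. `−Δ* ↦ −Δ + 3/(4R²)` on a low-aspect-ratio torus cross-section), with an
elementwise CLIPPED nonnegative majorant `b' ≥ σ·ms − v`, `b' ⪰ 0`.
[cite: FrankLaptevWeidl2022, Thm 1.52 (§1.2.8) with Thm 1.25 (§1.2.3)] [cite: Liu2015, Thm 2.1] -/
theorem liu_schrodinger_count_bound_of_nonneg (a a₀ ms v a' b' : LinearMap.BilinForm ℝ V)
    (ha'_symm : ∀ x y, a' x y = a' y x) (hb'_symm : ∀ x y, b' x y = b' y x)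
    (hb'_nonneg : ∀ x, 0 ≤ b' x x)
    (hv_nonneg : ∀ x, 0 ≤ v x x) (ha₀_nonneg : ∀ x, 0 ≤ a₀ x x) {σ : ℝ} (hσpos : 0 < σ)
    (ha₀_le : ∀ x, a₀ x x + v x x ≤ a x x)
    {k m : ℕ} (hmk : m < k) (u : Fin k → V) (lam : Fin k → ℝ) {Λ C s : ℝ}
    (hms_on : ∀ i j, ms (u i) (u j) = if i = j then 1 else 0)
    (ha_on : ∀ i j, a (u i) (u j) = if i = j then lam i else 0)
    (hlam : ∀ i, lam i ≤ Λ * σ) (hΛ : Λ < 1) (hC : 0 < C) (hs : 0 < s)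
    (ha'_le : ∀ x, a' x x ≤ a₀ x x) (hb_le : ∀ x, σ * ms x x - v x x ≤ b' x x)
    (proj : V →ₗ[ℝ] V) (ℓ : Fin m → V →ₗ[ℝ] ℝ)
    (horth : ∀ φ ∈ Submodule.span ℝ (Set.range u), a' (proj φ) (φ - proj φ) = 0)
    (happrox : ∀ φ ∈ Submodule.span ℝ (Set.range u),
      b' (φ - proj φ) (φ - proj φ) ≤ C ^ 2 * a' (φ - proj φ) (φ - proj φ))
    (hcoer : ∀ φ ∈ Submodule.span ℝ (Set.range u), (∀ j, ℓ j (proj φ) = 0) →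
      s * b' (proj φ) (proj φ) ≤ a' (proj φ) (proj φ)) :
    s ≤ Λ * (1 + C ^ 2 * s) := by
  classical
  let bσ : LinearMap.BilinForm ℝ V := σ • ms - v
  have hbσ : ∀ x y, bσ x y = σ * ms x y - v x y := fun x y => by
    simp [bσ, LinearMap.sub_apply, LinearMap.smul_apply, smul_eq_mul]
  let U : (Fin k → ℝ) →ₗ[ℝ] V := Fintype.linearCombination ℝ u
  have hU : ∀ c : Fin k → ℝ, U c = ∑ i, c i • u i := fun c => by
    simp [U, Fintype.linearCombination_apply]
  have hUmem : ∀ c : Fin k → ℝ, U c ∈ Submodule.span ℝ (Set.range u) := fun c => by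
    rw [hU]
    exact Submodule.sum_mem _ fun i _ => Submodule.smul_mem _ _ (Submodule.subset_span ⟨i, rfl⟩)
  have hray : ∀ y, a₀ (U y) (U y) ≤ Λ * bσ (U y) (U y) := fun y => by
    rw [hbσ, hU]
    exact schrodinger_span_rayleigh a a₀ ms v hv_nonneg ha₀_le u lam hms_on ha_on hlam hΛ.le y
  have hbpos : ∀ y, y ≠ 0 → 0 < bσ (U y) (U y) := by
    intro y hy
    rw [hbσ, hU]
    have hlow := schrodinger_span_mass_lower_of_nonneg a a₀ ms v ha₀_nonneg ha₀_le u lam (σ := σ)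
      hms_on ha_on hlam y
    obtain ⟨i, hi⟩ : ∃ i, y i ≠ 0 := by simpa using Function.ne_iff.mp hy
    have hle : y i ^ 2 ≤ ∑ j, y j ^ 2 :=
      Finset.single_le_sum (f := fun j => y j ^ 2) (fun j _ => sq_nonneg (y j)) (Finset.mem_univ i)
    have hyi : 0 < y i ^ 2 := by positivity
    have hsum : 0 < ∑ j, y j ^ 2 := lt_of_lt_of_le hyi hle
    have hgap : 0 < (1 - Λ) * σ := mul_pos (by linarith) hσpos
    nlinarith [mul_pos hgap hsum]
  exact liu_count_bound_span a₀ bσ a' b' ha'_symm hb'_symm hb'_nonneg hmk U hray hbpos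
    (fun y => ha'_le (U y)) (fun y => by rw [hbσ]; exact hb_le (U y)) hC hs proj ℓ
    (fun y => horth (U y) (hUmem y)) (fun y => happrox (U y) (hUmem y))
    (fun y hy => hcoer (U y) (hUmem y) hy)

/-- **Some Schrödinger level is `≥ lo·σ` (no `σ > sup V`).** As `exists_schrodinger_level_ge` with
`v ≤ V_max·ms`, `V_max < σ` replaced by `a₀ ⪰ 0`: a closed row `lo·(1 + C²s) ≤ s` with `lo ≤ 1` forces
`λ_i ≥ lo·σ` for some member of any `ms`-orthonormal `a`-diagonal family of `k > m` vectors.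
[cite: FrankLaptevWeidl2022, Thm 1.52 (§1.2.8) with Thm 1.25 (§1.2.3)] [cite: Liu2015, Thm 2.1 eq. (6)] -/
theorem exists_schrodinger_level_ge_of_nonneg (a a₀ ms v a' b' : LinearMap.BilinForm ℝ V)
    (ha'_symm : ∀ x y, a' x y = a' y x) (hb'_symm : ∀ x y, b' x y = b' y x)
    (hb'_nonneg : ∀ x, 0 ≤ b' x x)
    (hv_nonneg : ∀ x, 0 ≤ v x x) (ha₀_nonneg : ∀ x, 0 ≤ a₀ x x) {σ : ℝ} (hσpos : 0 < σ)
    (ha₀_le : ∀ x, a₀ x x + v x x ≤ a x x)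
    {k m : ℕ} (hmk : m < k) (u : Fin k → V) (lam : Fin k → ℝ) {lo C s : ℝ}
    (hms_on : ∀ i j, ms (u i) (u j) = if i = j then 1 else 0)
    (ha_on : ∀ i j, a (u i) (u j) = if i = j then lam i else 0)
    (hlo : lo ≤ 1) (hC : 0 < C) (hs : 0 < s) (hrow : lo * (1 + C ^ 2 * s) ≤ s)
    (ha'_le : ∀ x, a' x x ≤ a₀ x x) (hb_le : ∀ x, σ * ms x x - v x x ≤ b' x x)
    (proj : V →ₗ[ℝ] V) (ℓ : Fin m → V →ₗ[ℝ] ℝ)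
    (horth : ∀ φ ∈ Submodule.span ℝ (Set.range u), a' (proj φ) (φ - proj φ) = 0)
    (happrox : ∀ φ ∈ Submodule.span ℝ (Set.range u),
      b' (φ - proj φ) (φ - proj φ) ≤ C ^ 2 * a' (φ - proj φ) (φ - proj φ))
    (hcoer : ∀ φ ∈ Submodule.span ℝ (Set.range u), (∀ j, ℓ j (proj φ) = 0) →
      s * b' (proj φ) (proj φ) ≤ a' (proj φ) (proj φ)) :
    ∃ i, lo * σ ≤ lam i := by
  classical
  by_contra hne
  push Not at hne
  have hkpos : 0 < k := lt_of_le_of_lt (Nat.zero_le m) hmk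
  haveI : Nonempty (Fin k) := ⟨⟨0, hkpos⟩⟩
  obtain ⟨i₀, -, hi₀⟩ := Finset.exists_max_image Finset.univ lam Finset.univ_nonempty
  set Λ : ℝ := lam i₀ / σ with hΛdef
  have hlam : ∀ i, lam i ≤ Λ * σ := fun i => by
    rw [hΛdef, div_mul_cancel₀ _ hσpos.ne']
    exact hi₀ i (Finset.mem_univ i)
  have hΛlt : Λ < lo := by
    rw [hΛdef, div_lt_iff₀ hσpos]
    exact hne i₀
  have hΛ1 : Λ < 1 := lt_of_lt_of_le hΛlt hlo
  have hmain := liu_schrodinger_count_bound_of_nonneg a a₀ ms v a' b' ha'_symm hb'_symm hb'_nonneg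
    hv_nonneg ha₀_nonneg hσpos ha₀_le hmk u lam hms_on ha_on hlam hΛ1 hC hs ha'_le hb_le proj ℓ horth
    happrox hcoer
  have hden : (0 : ℝ) < 1 + C ^ 2 * s := by positivity
  have h1 : Λ * (1 + C ^ 2 * s) < lo * (1 + C ^ 2 * s) := mul_lt_mul_of_pos_right hΛlt hden
  linarith

/-- **Birman–Schwinger comparison count without `σ > sup V` (counting form, any family size).** As
`card_schrodinger_lt_le` with `v ≤ V_max·ms`, `V_max < σ` replaced by `a₀ ⪰ 0`: at most `m` levels of any
`ms`-orthonormal `a`-diagonal family lie below `lo·σ`, i.e. `λ_{m+1} ≥ lo·σ` for the client's enumeration —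
the statement used by the clipped («gs2c») elliptic-eigenvalue chain on domains reaching small `R`.
[cite: FrankLaptevWeidl2022, Thm 1.52 (§1.2.8, `≤` direction) with Thm 1.25] [cite: Liu2015, Thm 2.1 eq. (6)] -/
theorem card_schrodinger_lt_le_of_nonneg (a a₀ ms v a' b' : LinearMap.BilinForm ℝ V)
    (ha'_symm : ∀ x y, a' x y = a' y x) (hb'_symm : ∀ x y, b' x y = b' y x)
    (hb'_nonneg : ∀ x, 0 ≤ b' x x)
    (hv_nonneg : ∀ x, 0 ≤ v x x) (ha₀_nonneg : ∀ x, 0 ≤ a₀ x x) {σ : ℝ} (hσpos : 0 < σ)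
    (ha₀_le : ∀ x, a₀ x x + v x x ≤ a x x)
    {k m : ℕ} (u : Fin k → V) (lam : Fin k → ℝ) {lo C s : ℝ}
    (hms_on : ∀ i j, ms (u i) (u j) = if i = j then 1 else 0)
    (ha_on : ∀ i j, a (u i) (u j) = if i = j then lam i else 0)
    (hlo : lo ≤ 1) (hC : 0 < C) (hs : 0 < s) (hrow : lo * (1 + C ^ 2 * s) ≤ s)
    (ha'_le : ∀ x, a' x x ≤ a₀ x x) (hb_le : ∀ x, σ * ms x x - v x x ≤ b' x x)
    (proj : V →ₗ[ℝ] V) (ℓ : Fin m → V →ₗ[ℝ] ℝ)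
    (horth : ∀ φ ∈ Submodule.span ℝ (Set.range u), a' (proj φ) (φ - proj φ) = 0)
    (happrox : ∀ φ ∈ Submodule.span ℝ (Set.range u),
      b' (φ - proj φ) (φ - proj φ) ≤ C ^ 2 * a' (φ - proj φ) (φ - proj φ))
    (hcoer : ∀ φ ∈ Submodule.span ℝ (Set.range u), (∀ j, ℓ j (proj φ) = 0) →
      s * b' (proj φ) (proj φ) ≤ a' (proj φ) (proj φ)) :
    Fintype.card {i : Fin k // lam i < lo * σ} ≤ m := by
  classical
  by_contra hlt
  push Not at hlt
  set k' := Fintype.card {i : Fin k // lam i < lo * σ} with hk'def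
  let e : Fin k' ≃ {i : Fin k // lam i < lo * σ} := (Fintype.equivFin _).symm
  let u' : Fin k' → V := fun i => u (e i).1
  let lam' : Fin k' → ℝ := fun i => lam (e i).1
  have hinj : ∀ i j : Fin k', (e i).1 = (e j).1 ↔ i = j := fun i j =>
    ⟨fun h => e.injective (Subtype.ext h), fun h => by rw [h]⟩
  have hms_on' : ∀ i j, ms (u' i) (u' j) = if i = j then 1 else 0 := by
    intro i j
    show ms (u (e i).1) (u (e j).1) = _
    rw [hms_on]
    by_cases hij : i = j
    · rw [if_pos ((hinj i j).mpr hij), if_pos hij]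
    · rw [if_neg (fun h => hij ((hinj i j).mp h)), if_neg hij]
  have ha_on' : ∀ i j, a (u' i) (u' j) = if i = j then lam' i else 0 := by
    intro i j
    show a (u (e i).1) (u (e j).1) = _
    rw [ha_on]
    by_cases hij : i = j
    · rw [if_pos ((hinj i j).mpr hij), if_pos hij]
    · rw [if_neg (fun h => hij ((hinj i j).mp h)), if_neg hij]
  have hspan : Submodule.span ℝ (Set.range u') ≤ Submodule.span ℝ (Set.range u) :=
    Submodule.span_mono (by rintro _ ⟨i, rfl⟩; exact ⟨(e i).1, rfl⟩)
  obtain ⟨i, hi⟩ := exists_schrodinger_level_ge_of_nonneg a a₀ ms v a' b' ha'_symm hb'_symm hb'_nonneg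
    hv_nonneg ha₀_nonneg hσpos ha₀_le hlt u' lam' hms_on' ha_on' hlo hC hs hrow ha'_le hb_le proj ℓ
    (fun φ hφ => horth φ (hspan hφ)) (fun φ hφ => happrox φ (hspan hφ)) (fun φ hφ => hcoer φ (hspan hφ))
  exact absurd (e i).2 (not_lt.mpr hi)

end Literature.Analysis.OperatorTheory
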